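import Summits.CriticalPhenomena.CardyFormulaZ2.Theorems.CardyIKTransportIKMixedBoxCrossingTransportMonoDefs

/-!
# Stub `stub_lastFaceMono_of` (line `defect-closure-exploration`, reshape v5, crux `IKMixedBoxCrossing`,
# stmt-CriticalPhenomena-5911)

Support file (`--supports stmt-CriticalPhenomena-5911`): `LastColLinkMono → LastFaceMono`, the Fubini over the last
cell column and the last face column of the cylinder slab (bookkeeping only).

For the face types `Fin.snoc τ b` on the slab of `w + 1` face columns the slab weight factorises over the last face
column (`CylBunchStub.cylWeight_succ`, `Fin.snoc_castSucc`, `Fin.snoc_last`):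
`cylWeight (w+1) L (Fin.snoc τ b) x = cylWeight w L τ (resLast x) * lastColWeight b L …` (`cylWeight_snoc`).
Reindexing the configurations through `CylBunchStub.splitEquiv` (restriction, last colours, last flags):
* the numerator of `cylProb (w+1) L (Fin.snoc τ b) E` is `∑ y, cylWeight w L τ y * lastColSum b L E y` (`num_snoc`);
* the partition function is `cylZ w L τ * colConst b L` (`cylZ_snoc`, from `CylBunchStub.sum_resLast`);
so `cylArcs (w+1) L (Fin.snoc τ b) n` is the `cylWeight w L τ`-average of the normalised last-column sums
`lastColSum b L (arcsEvent (w+1) L n) y / colConst b L` (`cylArcs_snoc`), and the pointwise inequality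
`LastColLinkMono` integrates to `LastFaceMono` (nonnegative weights, `CylBunchStub.cylWeight_nonneg`,
`CylBunchStub.cylZ_nonneg`).
-/

noncomputable section

namespace Summit.CriticalPhenomena.CardyFormulaZ2.Cruxes.IKMixedBoxCrossing.DefectClosureExploration

open scoped BigOperators Classical
open Finset
open Summit.CriticalPhenomena.CardyFormulaZ2.Theorems.IKLinearTransport.PinnedDiagramExchange (faceWeight)
open CylBunchStub

namespace LastFaceMonoStub

/-- The slab weight for the face types `Fin.snoc τ b` factorises as the weight of the restriction (face types `τ`)
times the weight of the last face column (face type `b`). -/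
theorem cylWeight_snoc {w L : ℕ} [NeZero L] (τ : Fin w → Bool) (b : Bool) (x : CylCfg (w + 1) L) :
    cylWeight (w + 1) L (Fin.snoc τ b) x = cylWeight w L τ (resLast x) *
      lastColWeight b L (fun r => (resLast x).1 (Fin.last w, r)) (fun r => x.1 (Fin.last (w + 1), r))
        (fun r => x.2 (Fin.last w, r)) := by
  rw [cylWeight_succ]
  simp only [Fin.snoc_castSucc, Fin.snoc_last]
  rfl

/-- NUMERATOR: the weighted count of an event `E` of the wider slab, summed over the last cell column and the last
face column first, is the `cylWeight w L τ`-weighted sum of the last-column sums `lastColSum b L E`. -/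
theorem num_snoc {w L : ℕ} [NeZero L] (τ : Fin w → Bool) (b : Bool) (E : Set (CylCfg (w + 1) L)) :
    (∑ x : CylCfg (w + 1) L, if x ∈ E then cylWeight (w + 1) L (Fin.snoc τ b) x else 0) =
      ∑ y : CylCfg w L, cylWeight w L τ y * lastColSum b L E y := by
  rw [Fintype.sum_equiv (splitEquiv w L) _
      (fun p : CylCfg w L × ((ZMod L → Bool) × (ZMod L → Bool)) =>
        if (splitEquiv w L).symm p ∈ E then
          cylWeight w L τ p.1 * lastColWeight b L (fun r => p.1.1 (Fin.last w, r)) p.2.1 p.2.2 else 0)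
      (fun x => by simp only [Equiv.symm_apply_apply, cylWeight_snoc]; rfl),
    Fintype.sum_prod_type]
  refine Finset.sum_congr rfl fun y _ => ?_
  rw [lastColSum, Finset.mul_sum]
  refine Finset.sum_congr rfl fun p _ => ?_
  rw [mul_ite, mul_zero]

/-- PARTITION FUNCTION: `cylZ (w+1) L (Fin.snoc τ b) = cylZ w L τ * colConst b L` (`CylBunchStub.sum_resLast` with
the constant function `1`). -/
theorem cylZ_snoc {w L : ℕ} [NeZero L] (τ : Fin w → Bool) (b : Bool) :
    cylZ (w + 1) L (Fin.snoc τ b) = cylZ w L τ * colConst b L := by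
  unfold cylZ
  simpa only [one_mul, Fin.snoc_last, Fin.snoc_castSucc] using sum_resLast (Fin.snoc τ b) fun _ => (1 : ℝ)

/-- FUBINI: the arcs probability of the wider slab is the average, under the law of the narrower slab, of the
normalised weighted number of completions of the arcs event through the last face column. -/
theorem cylArcs_snoc {w L : ℕ} [NeZero L] (τ : Fin w → Bool) (b : Bool) (n : ℕ) :
    cylArcs (w + 1) L (Fin.snoc τ b) n =
      (∑ y : CylCfg w L, cylWeight w L τ y * (lastColSum b L (arcsEvent (w + 1) L n) y / colConst b L)) /
        cylZ w L τ := by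
  unfold cylArcs cylProb
  rw [num_snoc, cylZ_snoc]
  simp_rw [← mul_div_assoc]
  rw [← Finset.sum_div, div_div, mul_comm (colConst b L)]

end LastFaceMonoStub

open LastFaceMonoStub in
/-- **STUB · `stub_lastFaceMono_of`**: `LastColLinkMono → LastFaceMono`.  By `cylArcs_snoc` the two sides of
`LastFaceMono` are averages, with the same nonnegative weights `cylWeight w L τ` and the same partition function
`cylZ w L τ`, of the two sides of the pointwise inequality `LastColLinkMono`. -/
theorem stub_lastFaceMono_of : LastColLinkMono → LastFaceMono := by
  intro h w L n _ hL τ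
  rw [cylArcs_snoc, cylArcs_snoc]
  exact div_le_div_of_nonneg_right
    (Finset.sum_le_sum fun y _ => mul_le_mul_of_nonneg_left (h w L n hL y) (cylWeight_nonneg w L τ y))
    (cylZ_nonneg w L τ)

end Summit.CriticalPhenomena.CardyFormulaZ2.Cruxes.IKMixedBoxCrossing.DefectClosureExploration

end
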